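import Summits.HodgeConjecture.HodgeConjecture.Theorems.LinearSystemTorelliLocalTubeSpanFrameLiftBasic
import Summits.HodgeConjecture.HodgeConjecture.Theorems.LinearSystemTorelliLocalTubeSpanPlaneCalculus
import Summits.HodgeConjecture.HodgeConjecture.Theorems.LinearSystemTorelliLocalTubeSpanEuclidGame
import Summits.HodgeConjecture.HodgeConjecture.Theorems.LinearSystemTorelliLocalTubeSpanCoprimeShift
import Mathlib.Tactic.Module
import Mathlib.RingTheory.Coprime.Lemmas

/-!
# Route LinearSystemTorelli — crux `LocalTubeSpan` (stmt-HodgeConjecture-2490): unimodular transitivity of the level-2 elementary moves — lemmas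

Helper file (`--supports stmt-HodgeConjecture-2490`, line `Sketch` of the crux chain, cycle 7,
continuation lead c6; first half of the lead's stub `stub_unimodularTransitivity`, the hardest of the
cycle — the main theorem is in `…UnimodularTransitivity`).  THIS FILE: integrality on `ℤΔ`, the pair
move (isometry, lattice), pull-back of reachability, and the reachable pairs `(1,0)`, `(-1,0)` and
every COPRIME pair `(A, β)` (the Euclid game).

Let `Λ = ℤΔ` be a lattice in the `ℚ`-space `V` on which the alternating form `B` is integral, and let
`Γ ≤ GL(V)` contain the two ELEMENTARY families of the level-2 congruence subgroup `Sp♯₂(Λ)`: the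
squared transvection pairs `E_{e,f}² : v ↦ v + 2(⟨v,e⟩f + ⟨v,f⟩e)` (`e, f ∈ Λ`, `⟨e, f⟩ = 0`) and the
squares `T_a² : v ↦ v - 2⟨v,a⟩a` (`a ∈ Λ`) — for the monodromy group `Γ_Δ` of a skew vanishing
lattice these memberships are Janssen's Theorem 2.5 (`localTubeSpan_sp2Elementary`, file
`…Sp2Elementary`).  MAIN THEOREM `localTubeSpan_unimodularTransitivity`: if `x, y ∈ Λ` with
`⟨x, y⟩ = 1`, then every UNIMODULAR `t ∈ x + 2Λ` (`⟨t, y'⟩ = 1` for some `y' ∈ Λ`) is `g x` for some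
`g ∈ Γ`.  This is the content of Janssen's Theorem 2.9 (`x ∈ Δ ↔ x` unimodular `∧ x ≡ δ mod 2Λ`),
which thereby becomes a corollary of Theorem 2.5 (file `…OneFact`).

Proof (coordinates `A = ⟨t, y⟩`, odd, and `β = ⟨z, x⟩` for `t = x + 2z`):
* `(A, β) = (1, 0)`: `t = E_{y,z}² x` (`localTubeSpan_reach_of_one_zero`);
* `(A, β) = (-1, 0)`: the word `T_x² T_y² T_{x+y}²` is `-1` on the plane `(x, y)` and `1` on its
  orthogonal (`…PlaneCalculus`), moving `t` to the previous case (`localTubeSpan_reach_of_neg_one_zero`);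
* `(A, β)` coprime: powers of `T_y²` (`β ↦ β ∓ kA`) and of `T_x²` (`A ↦ A ∓ 4kβ`) play the Euclid
  game of `…EuclidGame` down to `(±1, 0)` (`localTubeSpan_reach_of_isCoprime`);
* `β ≠ 0`: a partner `y'` of `t` splits as `y' = ⟨y',y⟩x - ⟨y',x⟩y + w₁` with `w₁ ⟂ x, y` and
  `-⟨y',x⟩A + 2⟨y',y⟩β + ⟨t, w₁⟩ = 1`; the move `E_{x, s w₁}²` shifts `A ↦ A + 2s⟨t, w₁⟩`, coprime to
  `β` for the `s` of `…CoprimeShift` (`localTubeSpan_reach_of_ne_zero`);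
* `β = 0`, `A ≠ ±1`: one move `E_{y, w₁}²` makes `β = -⟨t, w₁⟩ ≠ 0`, unimodularity being transported
  along the isometry.

No named facts (the two move families are hypotheses); no `sorry`.
-/

-- `Summit.HodgeConjecture.HodgeConjecture.Theorems` is the mandated namespace (single-conjunct summit:
-- Sub = Summit), which `linter.dupNamespace` flags on every declaration; the lakefile turns the
-- linter off tree-wide (weak option), restated here so stand-alone elaboration is warning-free too.

set_option linter.dupNamespace false

noncomputable section

open Literature.AlgebraicGeometry.HodgeTheory

namespace Summit.HodgeConjecture.HodgeConjecture.Theorems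

variable {V : Type} [AddCommGroup V] [Module ℚ V]


/-! ### Basics: integrality on the lattice, the pair move, the square move -/

section Basics

variable (B : LinearMap.BilinForm ℚ V)

/-- Integrality of `B` on `ℤΔ × ℤΔ` from integrality on `Δ × Δ`. [folklore] -/
theorem localTubeSpan_integral_span (Δ : Set V) (hint : ∀ δ ∈ Δ, ∀ δ' ∈ Δ, ∃ n : ℤ, B δ δ' = n)
    {u v : V} (hu : u ∈ Submodule.span ℤ Δ) (hv : v ∈ Submodule.span ℤ Δ) :
    ∃ n : ℤ, B u v = n := by
  refine localTubeSpan_exists_int_eq_of_mem_span_int B Δ v (fun δ hδ => ?_) hu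
  obtain ⟨n, hn⟩ := localTubeSpan_exists_int_eq_of_mem_span_int B.flip Δ δ
    (fun δ' hδ' => by
      obtain ⟨n, hn⟩ := hint δ hδ δ' hδ'
      exact ⟨n, by rw [LinearMap.BilinForm.flip_apply, hn]⟩) hv
  exact ⟨n, by rw [← hn, LinearMap.BilinForm.flip_apply]⟩

/-- A map acting as the squared transvection pair `x ↦ x + 2(⟨x,e⟩f + ⟨x,f⟩e)` with `⟨e, f⟩ = 0`
is an isometry of the alternating form `B`. [folklore] -/
theorem localTubeSpan_pairMove_isometry (hB : B.IsAlt) {e f : V} (hef : B e f = 0)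
    (g : V →ₗ[ℚ] V) (hg : ∀ v, g v = v + (2 : ℚ) • (B v e • f + B v f • e)) (u v : V) :
    B (g u) (g v) = B u v := by
  have hfe : B f e = 0 := by rw [← hB.neg_eq, hef, neg_zero]
  have hue : B e u = -B u e := (hB.neg_eq u e).symm
  have huf : B f u = -B u f := (hB.neg_eq u f).symm
  have hve : B e v = -B v e := (hB.neg_eq v e).symm
  have hvf : B f v = -B v f := (hB.neg_eq v f).symm
  rw [hg u, hg v]
  simp only [map_add, map_smul, LinearMap.add_apply, LinearMap.smul_apply, smul_eq_mul,
    hB.self_eq_zero, hef, hfe, hve, hvf]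
  ring

/-- A map acting as `x ↦ x + 2(⟨x,e⟩f + ⟨x,f⟩e)` with `e, f ∈ ℤΔ` preserves `ℤΔ` (integral `B`).
[folklore] -/
theorem localTubeSpan_pairMove_mem_span (Δ : Set V)
    (hint : ∀ δ ∈ Δ, ∀ δ' ∈ Δ, ∃ n : ℤ, B δ δ' = n) {e f : V}
    (he : e ∈ Submodule.span ℤ Δ) (hf : f ∈ Submodule.span ℤ Δ)
    (g : V →ₗ[ℚ] V) (hg : ∀ v, g v = v + (2 : ℚ) • (B v e • f + B v f • e)) {u : V}
    (hu : u ∈ Submodule.span ℤ Δ) : g u ∈ Submodule.span ℤ Δ := by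
  obtain ⟨m, hm⟩ := localTubeSpan_integral_span B Δ hint hu he
  obtain ⟨n, hn⟩ := localTubeSpan_integral_span B Δ hint hu hf
  rw [hg u, hm, hn, show (2 : ℚ) • ((m : ℚ) • f + (n : ℚ) • e) = ((2 * m : ℤ) : ℚ) • f +
    ((2 * n : ℤ) : ℚ) • e by push_cast; module, Int.cast_smul_eq_zsmul, Int.cast_smul_eq_zsmul]
  exact Submodule.add_mem _ hu (Submodule.add_mem _ (Submodule.smul_mem _ _ hf)
    (Submodule.smul_mem _ _ he))

end Basics

/-! ### Reachability from `x` by the moves of `Γ` -/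

section Reach

variable (B : LinearMap.BilinForm ℚ V) (hB : B.IsAlt) (Δ : Set V)
  (hint : ∀ δ ∈ Δ, ∀ δ' ∈ Δ, ∃ n : ℤ, B δ δ' = n)
  (Γ : Subgroup (V →ₗ[ℚ] V)ˣ)
  (hpair : ∀ e ∈ Submodule.span ℤ Δ, ∀ f ∈ Submodule.span ℤ Δ, B e f = 0 →
    ∃ g ∈ Γ, ∀ x : V, ((g : (V →ₗ[ℚ] V)ˣ) : V →ₗ[ℚ] V) x = x + (2 : ℚ) • (B x e • f + B x f • e))
  (hsq : ∀ a ∈ Submodule.span ℤ Δ, ∃ g ∈ Γ, ∀ x : V,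
    ((g : (V →ₗ[ℚ] V)ˣ) : V →ₗ[ℚ] V) x = x - (2 : ℚ) • (B x a • a))
  {x y : V} (hx : x ∈ Submodule.span ℤ Δ) (hy : y ∈ Submodule.span ℤ Δ) (hxy : B x y = 1)

/-- Pull back reachability along a move: if `g ∈ Γ` and `g t` is reachable from `x`, so is `t`.
[folklore] -/
theorem localTubeSpan_reach_of_reach_apply {g : (V →ₗ[ℚ] V)ˣ} (hg : g ∈ Γ) {t : V}
    (h : ∃ g' ∈ Γ, ((g' : (V →ₗ[ℚ] V)ˣ) : V →ₗ[ℚ] V) x = (g : V →ₗ[ℚ] V) t) :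
    ∃ g' ∈ Γ, ((g' : (V →ₗ[ℚ] V)ˣ) : V →ₗ[ℚ] V) x = t := by
  obtain ⟨g', hg', hg'x⟩ := h
  refine ⟨g⁻¹ * g', Γ.mul_mem (Γ.inv_mem hg) hg', ?_⟩
  rw [Units.val_mul, Module.End.mul_apply, hg'x, localTubeSpan_units_inv_apply_apply]

include hpair hxy in
/-- The pair `(A, β) = (1, 0)`: `t = x + 2z` with `⟨t, y⟩ = 1`, `⟨t, x⟩ = 0` is `E_{y,z}² x`. [folklore] -/
theorem localTubeSpan_reach_of_one_zero (hB : B.IsAlt) (hy : y ∈ Submodule.span ℤ Δ)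
    {t z : V} (hz : z ∈ Submodule.span ℤ Δ)
    (ht : t = x + (2 : ℚ) • z) (hty : B t y = 1) (htx : B t x = 0) :
    ∃ g ∈ Γ, ((g : (V →ₗ[ℚ] V)ˣ) : V →ₗ[ℚ] V) x = t := by
  have hzy : B z y = 0 := by
    have h := hty
    rw [ht, map_add, map_smul, LinearMap.add_apply, LinearMap.smul_apply, hxy, smul_eq_mul] at h
    linarith
  have hzx : B z x = 0 := by
    have h := htx
    rw [ht, map_add, map_smul, LinearMap.add_apply, LinearMap.smul_apply, hB.self_eq_zero,
      smul_eq_mul] at h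
    linarith
  have hyz : B y z = 0 := by rw [← hB.neg_eq, hzy, neg_zero]
  have hxz : B x z = 0 := by rw [← hB.neg_eq, hzx, neg_zero]
  obtain ⟨g, hg, hgf⟩ := hpair y hy z hz hyz
  refine ⟨g, hg, ?_⟩
  rw [hgf, hxy, hxz, ht]
  module

include hpair hsq hxy in
/-- The pair `(A, β) = (-1, 0)`: the word `T_x² T_y² T_{x+y}²` acts as `-1` on the plane and moves
`t` to `t + 2x`, which has the pair `(1, 0)`. [folklore] -/
theorem localTubeSpan_reach_of_neg_one_zero (hB : B.IsAlt) (hx : x ∈ Submodule.span ℤ Δ)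
    (hy : y ∈ Submodule.span ℤ Δ) {t z : V} (hz : z ∈ Submodule.span ℤ Δ)
    (ht : t = x + (2 : ℚ) • z) (hty : B t y = -1) (htx : B t x = 0) :
    ∃ g ∈ Γ, ((g : (V →ₗ[ℚ] V)ˣ) : V →ₗ[ℚ] V) x = t := by
  obtain ⟨gx, hgx, hgxf⟩ := hsq x hx
  obtain ⟨gy, hgy, hgyf⟩ := hsq y hy
  obtain ⟨gxy, hgxy, hgxyf⟩ := hsq (x + y) (Submodule.add_mem _ hx hy)
  -- the word acts as `v ↦ v - 2(⟨v,y⟩x - ⟨v,x⟩y)`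
  have hword : ∀ v, ((gx * gy * gxy : (V →ₗ[ℚ] V)ˣ) : V →ₗ[ℚ] V) v =
      v - (2 : ℚ) • (B v y • x - B v x • y) := by
    intro v
    rw [Units.val_mul, Units.val_mul, Module.End.mul_apply, Module.End.mul_apply, hgxyf, hgyf,
      hgxf, ← localTubeSpan_skewTransvection_sq_apply B hB (x + y) v,
      ← localTubeSpan_skewTransvection_sq_apply B hB y,
      ← localTubeSpan_skewTransvection_sq_apply B hB x]
    exact (localTubeSpan_planeCalculus B hB).1 x y hxy v
  have hg0 : gx * gy * gxy ∈ Γ := Γ.mul_mem (Γ.mul_mem hgx hgy) hgxy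
  refine localTubeSpan_reach_of_reach_apply Γ hg0 ?_
  refine localTubeSpan_reach_of_one_zero B Δ Γ hpair hxy hB hy (z := z + x)
    (Submodule.add_mem _ hz hx) ?_ ?_ ?_
  · rw [hword, hty, htx, ht]; module
  · rw [hword, hty, htx, map_sub, map_smul, LinearMap.sub_apply, LinearMap.smul_apply, hty,
      map_sub, map_smul, map_smul, LinearMap.sub_apply, LinearMap.smul_apply,
      LinearMap.smul_apply, hxy, hB.self_eq_zero]
    norm_num
  · rw [hword, hty, htx, map_sub, map_smul, LinearMap.sub_apply, LinearMap.smul_apply, htx,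
      map_sub, map_smul, map_smul, LinearMap.sub_apply, LinearMap.smul_apply,
      LinearMap.smul_apply, hB.self_eq_zero, show B y x = -1 by rw [← hB.neg_eq, hxy]]
    norm_num

/-- `((n : ℤ) : ℚ) • v ∈ ℤΔ` for `v ∈ ℤΔ`. [folklore] -/
theorem localTubeSpan_intCast_smul_mem {v : V} (hv : v ∈ Submodule.span ℤ Δ) (n : ℤ) :
    ((n : ℚ)) • v ∈ Submodule.span ℤ Δ := by
  rw [Int.cast_smul_eq_zsmul]
  exact Submodule.smul_mem _ _ hv

include hpair hsq hxy in
/-- The COPRIME case: `t = x + 2z` with `(⟨t, y⟩, ⟨z, x⟩) = (A, β)` coprime is reachable — the Euclid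
game on `(A, β)` played with powers of `T_y²` (`β ↦ β ∓ kA`) and `T_x²` (`A ↦ A ∓ 4kβ`) down to
`(±1, 0)`. [folklore] -/
theorem localTubeSpan_reach_of_isCoprime (hB : B.IsAlt)
    (hint : ∀ δ ∈ Δ, ∀ δ' ∈ Δ, ∃ n : ℤ, B δ δ' = n)
    (hx : x ∈ Submodule.span ℤ Δ) (hy : y ∈ Submodule.span ℤ Δ)
    {t z : V} (hz : z ∈ Submodule.span ℤ Δ) (ht : t = x + (2 : ℚ) • z)
    {A β : ℤ} (htA : B t y = A) (hzβ : B z x = β) (hcop : IsCoprime A β) :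
    ∃ g ∈ Γ, ((g : (V →ₗ[ℚ] V)ˣ) : V →ₗ[ℚ] V) x = t := by
  have hyx : B y x = -1 := by rw [← hB.neg_eq, hxy]
  -- `A` is odd
  have hAodd : Odd A := by
    obtain ⟨n, hn⟩ := localTubeSpan_integral_span B Δ hint hz hy
    have h : (A : ℚ) = 2 * n + 1 := by
      rw [← htA, ht, map_add, map_smul, LinearMap.add_apply, LinearMap.smul_apply, hxy, hn,
        smul_eq_mul]
      ring
    exact ⟨n, by exact_mod_cast h⟩
  obtain ⟨gx, hgx, hgxf⟩ := hsq x hx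
  obtain ⟨gy, hgy, hgyf⟩ := hsq y hy
  have hPx := (localTubeSpan_planeCalculus B hB).2 x gx hgxf
  have hPy := (localTubeSpan_planeCalculus B hB).2 y gy hgyf
  refine localTubeSpan_euclidGame
    (fun A β => ∀ t z : V, z ∈ Submodule.span ℤ Δ → t = x + (2 : ℚ) • z → B t y = A →
      B z x = β → ∃ g ∈ Γ, ((g : (V →ₗ[ℚ] V)ˣ) : V →ₗ[ℚ] V) x = t)
    ?_ ?_ ?_ ?_ A β hAodd hcop t z hz ht htA hzβ
  · -- `β ↦ β + kA` by powers of `T_y²`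
    intro A β k hP t z hz ht htA hzβ
    rcases Int.eq_nat_or_neg k with ⟨m, rfl | rfl⟩
    · -- `k = m`: apply `(T_y²)^{-m}`, which adds `2mA y`
      refine localTubeSpan_reach_of_reach_apply Γ (Γ.pow_mem (Γ.inv_mem hgy) m) ?_
      refine hP _ (z + (((m : ℤ) * A : ℤ) : ℚ) • y)
        (Submodule.add_mem _ hz (localTubeSpan_intCast_smul_mem Δ hy _)) ?_ ?_ ?_
      · rw [(hPy m t).2, htA, ht]
        push_cast
        module
      · rw [(hPy m t).2, htA, map_add, map_smul, LinearMap.add_apply, LinearMap.smul_apply, htA,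
          map_smul, LinearMap.smul_apply, hB.self_eq_zero, smul_eq_mul, smul_eq_mul, mul_zero,
          mul_zero, add_zero]
      · rw [map_add, map_smul, LinearMap.add_apply, LinearMap.smul_apply, hzβ, hyx, smul_eq_mul]
        push_cast
        ring
    · -- `k = -m`: apply `(T_y²)^{m}`, which subtracts `2mA y`
      refine localTubeSpan_reach_of_reach_apply Γ (Γ.pow_mem hgy m) ?_
      refine hP _ (z - (((m : ℤ) * A : ℤ) : ℚ) • y)
        (Submodule.sub_mem _ hz (localTubeSpan_intCast_smul_mem Δ hy _)) ?_ ?_ ?_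
      · rw [(hPy m t).1, htA, ht]
        push_cast
        module
      · rw [(hPy m t).1, htA, map_sub, map_smul, LinearMap.sub_apply, LinearMap.smul_apply, htA,
          map_smul, LinearMap.smul_apply, hB.self_eq_zero, smul_eq_mul, smul_eq_mul, mul_zero,
          mul_zero, sub_zero]
      · rw [map_sub, map_smul, LinearMap.sub_apply, LinearMap.smul_apply, hzβ, hyx, smul_eq_mul]
        push_cast
        ring
  · -- `A ↦ A + 4kβ` by powers of `T_x²`
    intro A β k hP t z hz ht htA hzβ
    have htx : B t x = 2 * β := by
      rw [ht, map_add, map_smul, LinearMap.add_apply, LinearMap.smul_apply, hB.self_eq_zero, hzβ,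
        smul_eq_mul, zero_add]
    rcases Int.eq_nat_or_neg k with ⟨m, rfl | rfl⟩
    · -- `k = m`: apply `(T_x²)^{m}`, which subtracts `4mβ x`
      refine localTubeSpan_reach_of_reach_apply Γ (Γ.pow_mem hgx m) ?_
      refine hP _ (z - ((2 * (m : ℤ) * β : ℤ) : ℚ) • x)
        (Submodule.sub_mem _ hz (localTubeSpan_intCast_smul_mem Δ hx _)) ?_ ?_ ?_
      · rw [(hPx m t).1, htx, ht]
        push_cast
        module
      · rw [(hPx m t).1, htx, map_sub, map_smul, LinearMap.sub_apply, LinearMap.smul_apply, htA,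
          map_smul, LinearMap.smul_apply, hxy, smul_eq_mul, smul_eq_mul]
        push_cast
        ring
      · rw [map_sub, map_smul, LinearMap.sub_apply, LinearMap.smul_apply, hzβ, hB.self_eq_zero,
          smul_eq_mul, mul_zero, sub_zero]
    · -- `k = -m`: apply `(T_x²)^{-m}`, which adds `4mβ x`
      refine localTubeSpan_reach_of_reach_apply Γ (Γ.pow_mem (Γ.inv_mem hgx) m) ?_
      refine hP _ (z + ((2 * (m : ℤ) * β : ℤ) : ℚ) • x)
        (Submodule.add_mem _ hz (localTubeSpan_intCast_smul_mem Δ hx _)) ?_ ?_ ?_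
      · rw [(hPx m t).2, htx, ht]
        push_cast
        module
      · rw [(hPx m t).2, htx, map_add, map_smul, LinearMap.add_apply, LinearMap.smul_apply, htA,
          map_smul, LinearMap.smul_apply, hxy, smul_eq_mul, smul_eq_mul]
        push_cast
        ring
      · rw [map_add, map_smul, LinearMap.add_apply, LinearMap.smul_apply, hzβ, hB.self_eq_zero,
          smul_eq_mul, mul_zero, add_zero]
  · -- base `(1, 0)`
    intro t z hz ht htA hzβ
    refine localTubeSpan_reach_of_one_zero B Δ Γ hpair hxy hB hy hz ht (by rw [htA, Int.cast_one])
      ?_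
    rw [ht, map_add, map_smul, LinearMap.add_apply, LinearMap.smul_apply, hB.self_eq_zero, hzβ,
      Int.cast_zero, smul_zero, add_zero]
  · -- base `(-1, 0)`
    intro t z hz ht htA hzβ
    refine localTubeSpan_reach_of_neg_one_zero B Δ Γ hpair hsq hxy hB hx hy hz ht
      (by rw [htA, Int.cast_neg, Int.cast_one]) ?_
    rw [ht, map_add, map_smul, LinearMap.add_apply, LinearMap.smul_apply, hB.self_eq_zero, hzβ,
      Int.cast_zero, smul_zero, add_zero]

end Reach

end Summit.HodgeConjecture.HodgeConjecture.Theorems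

end
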